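import Summits.NavierStokesRegularity.NavierStokesRegularity.Theses.SymmetryModuliCount
import Literature.Analysis.FluidPDE.TypeIAncientMild

/-!
# Line `time-anchor-bootstrap` — crux `ForcedSymmetry` (stmt-NavierStokesRegularity-4052, route SymmetryModuliCount)

Skeleton of the line built from the crux idea `Ideas/time-anchor-bootstrap.md` (ideator 2; algebra
machine-checked in `Cruxes/ForcedSymmetry/Ideator2Sketch.lean`) as sharpened by the three triage
notes `TRIAGE-r1-{1,2,3}.md` (all: pass; merge-partner `backward-shift-self-improvement`, whose
VERTEX LEMMA is adopted here as stub 3). Gen 1 by planner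
`planner-cruxplan-stmt-NavierStokesRegularity-4052-time-anchor-bootstra-0`; **gen 2 (this file) by the
lead prover `prover-line-stmt-NavierStokesRegularity-4052-0`, 2026-08-16 — RESHAPE: (i) every stub
signature is now written in TREE VOCABULARY ONLY (`fderiv`, `timeDeriv`, `IsTypeIAncientMild`; the local
`extGen` survives only in the algebra/composition), so a `Theorems/` file proves a stub verbatim without
importing this module; (ii) stub 2 `futureVertexLiouville` is SPLIT along `A = 0` / `A ≠ 0` into
`stub_futureVertexLiouvilleIrrotational` (KNOWN: Euler homogeneity ⇒ bounded Leray profile ⇒ constant by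
Tsai 1998 Thm 1 `q = ∞` = tree theorem `tsai_selfsimilar_bounded_holds` ⇒ `0` by the gauge
`IsTypeIAncientMild.eq_zero_of_slice_const`) and `stub_futureVertexLiouvilleRotated` (OPEN: the
RSS-bounded-profile leaf shared with the sibling crux 4053, `Cruxes/SymmetricLiouville/Disproof.lean`
`RotatedSelfSimilarLiouville`, Pineau–Vicol arXiv:2607.09619 Conj. 1.1 / Tsai 2018 Conj. 8.9); the
composition is unchanged up to the case split on `A = 0`. Five registered stubs (≤ stubs_max = 7).**

THE LEVER. The crux types the infinitesimal similarity `L_ξ u = ∇u·(a+σx+Ax) + σu + 2σt ∂ₜu − Au`,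
i.e. scalings anchored at the FINAL time `t = 0`, while the class `A_C` (`IsTypeIAncientMild C`) is
invariant under backward time shifts (`IsTypeIAncientMild.comp_sub_right`). Writing the generator with
one more slot, `extGen u a σ A τ = ∇u·(a+σx+Ax) + σu + (2σt+τ)∂ₜu − Au` (`(a,σ,A,τ) ∈ ⟨∂ₜ⟩ ⊕ sim(3)`;
a scaling with space–time vertex `(θ, x_c)` has `τ = −2σθ`), the extended stabiliser of a NONZERO
`u ∈ A_C` can only be (i) a rigid co-motion `σ = 0, τ ≠ 0` — killed by the Type-I rate at `t = −∞`
(stub 4, elementary); (ii) a scaling with INTERIOR vertex `θ < 0` — killed by continuity at the vertex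
(stub 3 = the vertex lemma, elementary); (iii) a Killing field `σ = τ = 0` — which IS a crux witness;
(iv) a scaling with vertex ON the final slice `θ = 0` — which IS a crux witness; (v) a scaling with
FUTURE vertex `θ > 0` — a rotated/plain self-similar soliton about a point of the future, which has NO
`t = 0`-anchored symmetry unless it vanishes: stubs 2a/2b. Hence

  `ForcedSymmetry ⇐ ExtendedForcedSymmetry ∧ FutureVertexLiouville{Irrotational,Rotated} ∧
   InteriorVertexVanishing ∧ RigidComotionVanishing`   (`ForcedSymmetry_of`, kernel-checked, pure logic),

where `ExtendedForcedSymmetry` (stub 1, HARDEST) is the crux RE-ANCHORED: every Type-I KNSS-mild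
ancient field is annihilated by a nonzero element of the EXTENDED algebra `⟨∂ₜ⟩ ⊕ sim(3)` (any
space–time vertex, time translation allowed). This is the card's "honest two-crux form"
(Transfer (iii); TRIAGE-r1-1 (c), r1-2 finding 1, r1-3 recommendation).

TIGHTNESS (sorry-free, this file): both hard stubs are NECESSARY for the crux —
`extendedForcedSymmetry_of_forcedSymmetry : ForcedSymmetry → Sig.stub_extendedForcedSymmetry` (τ = 0)
and `futureVertexLiouville_of_forcedSymmetry : Sig.stub_rigidComotionVanishing → KillingLiouville →
ForcedSymmetry → FutureVertexLiouville` (the bootstrap itself: a future-anchored soliton plus a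
`t = 0`-anchored symmetry combine, `extGen_combine`, to a rigid co-motion with `τ ≠ 0`, or the `t = 0`
symmetry is Killing). So modulo the elementary stub 4 and the Killing leaf of the sibling crux,
`ForcedSymmetry ⇔ stub 1 ∧ (stub 2a ∧ stub 2b)`.

DISPROOF USED (`Cruxes/ForcedSymmetry/Disproof.lean`, cdisprove v3, read 2026-08-16 by the lead):
`forcedSymmetry_false_without_H3` — honoured at stub 1 (its drop-H3 version is refuted by the same
witness `w = e^{t/2}e^{−‖x‖²}(rot x + x₀ rot0 x)`) and at stubs 2a/2b (drop-H3 version refuted by the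
parasitic soliton `c(θ−t)^{-1/2}e₀`, `θ > 0`, not KNSS-mild by `IsTypeIAncientMild.eq_zero_of_slice_const`);
`not_forcedSymmetryOnDriftClass` — no engine for stub 1 may treat `u` as a mere Type-I drift;
`forcedSymmetry_of_typeIAncientLiouville` (`X ⇒` crux) — consistent: `X ⇒` every stub; §5 boundary
(`A_C = {0}` for `C ≤ ε`) — every stub is vacuously true there. Stubs 3–4 use only H1 (joint
smoothness) resp. H1 + H4 (Type-I rate at `−∞`); consistent with the H3-obstruction because their
hypotheses contain a symmetry the witness `w` does not have. No `-- Targets` kill exists for any stub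
of this line (Disproof has no Targets section yet); landed `Theorems/ForcedSymmetry/Negative/{Witness,
WithoutOseen}.lean` contain the calculus of `w` and the drop-H3 refutations only.

Everything analytic is inside the five `stub_*`; everything else is algebra/logic and is proved.
-/

noncomputable section

set_option linter.dupNamespace false

namespace Summit.NavierStokesRegularity.NavierStokesRegularity.Cruxes.ForcedSymmetry.TimeAnchorBootstrap

open Literature.Analysis.FluidPDE MeasureTheory Set Function

open Summit.NavierStokesRegularity.NavierStokesRegularity.Theses.SymmetryModuliCount
  (ForcedSymmetry TypeIAncientLiouville SymmetricLiouville)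

/-- `ℝ³` as in the route file. -/
abbrev E3 : Type := EuclideanSpace ℝ (Fin 3)

/-! ## The extended generator (algebra only; no stub signature mentions it) -/

/-- The EXTENDED infinitesimal generator of `(a, σ, A, τ) ∈ ⟨∂ₜ⟩ ⊕ sim(3)` acting on `u`:
`∇u·(a + σx + Ax) + σu + (2σt + τ)∂ₜu − Au`. The crux's `L_ξ u` is `τ = 0` (vertex on the final slice
`t = 0`); a (rotated) scaling with space–time vertex `(θ, x_c)` has `τ = −2σθ` (and `a = −(σ + A)x_c`);
`σ = 0, τ ≠ 0` is a rigid co-motion (travelling / rotating wave, steady state); `σ = τ = 0` is a Killing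
field (translation, rotation, screw). -/
def extGen (u : ℝ → E3 → E3) (a : E3) (σ : ℝ) (A : E3 →L[ℝ] E3) (τ : ℝ) (t : ℝ) (x : E3) : E3 :=
  fderiv ℝ (u t) x (a + σ • x + A x) + σ • u t x + (2 * σ * t + τ) • timeDeriv u t x - A (u t x)

/-- At `τ = 0` the extended generator is the crux's `L_ξ u`, syntactically. -/
theorem extGen_tau_zero (u : ℝ → E3 → E3) (a : E3) (σ : ℝ) (A : E3 →L[ℝ] E3) (t : ℝ) (x : E3) :
    extGen u a σ A 0 t x =
      fderiv ℝ (u t) x (a + σ • x + A x) + σ • u t x + (2 * σ * t) • timeDeriv u t x - A (u t x) := by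
  simp [extGen]

/-- At `σ = 0` the extended generator is the rigid co-motion generator `∇u·(a + Ax) + τ∂ₜu − Au`. -/
theorem extGen_sigma_zero (u : ℝ → E3 → E3) (a : E3) (A : E3 →L[ℝ] E3) (τ t : ℝ) (x : E3) :
    extGen u a 0 A τ t x = fderiv ℝ (u t) x (a + A x) + τ • timeDeriv u t x - A (u t x) := by
  simp [extGen]

/-- With `τ = −2σθ` the extended generator is the scaling generator about the time vertex `θ`:
`∇u·(a + σx + Ax) + σu + 2σ(t − θ)∂ₜu − Au`. -/
theorem extGen_vertex (u : ℝ → E3 → E3) (a : E3) (σ : ℝ) (A : E3 →L[ℝ] E3) (θ t : ℝ) (x : E3) :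
    extGen u a σ A (-2 * σ * θ) t x =
      fderiv ℝ (u t) x (a + σ • x + A x) + σ • u t x + (2 * σ * (t - θ)) • timeDeriv u t x - A (u t x) := by
  simp only [extGen]
  congr 2
  ring

/-- The same at `A = 0`: `∇u·(a + σx) + σu + 2σ(t − θ)∂ₜu`. -/
theorem extGen_vertex_irrot (u : ℝ → E3 → E3) (a : E3) (σ : ℝ) (θ t : ℝ) (x : E3) :
    extGen u a σ 0 (-2 * σ * θ) t x =
      fderiv ℝ (u t) x (a + σ • x) + σ • u t x + (2 * σ * (t - θ)) • timeDeriv u t x := by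
  rw [extGen_vertex]
  simp

/-- **Linearity: subtraction of two generators.** From `(a₀, σ₀, A₀, 0)` and `(a₁, σ₁, A₁, τ₁)` both
annihilating `u` on `t < T` one gets the `σ = 0` generator `(σ₁a₀ − σ₀a₁, 0, σ₁A₀ − σ₀A₁, −σ₀τ₁)`
(rigid co-motion if `σ₀τ₁ ≠ 0`, Killing otherwise). Ported from `Ideator2Sketch.extGen_combine`. -/
theorem extGen_combine {u : ℝ → E3 → E3} {a₀ a₁ : E3} {σ₀ σ₁ τ₁ T : ℝ} {A₀ A₁ : E3 →L[ℝ] E3}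
    (h₀ : ∀ t < T, ∀ x, extGen u a₀ σ₀ A₀ 0 t x = 0)
    (h₁ : ∀ t < T, ∀ x, extGen u a₁ σ₁ A₁ τ₁ t x = 0) :
    ∀ t < T, ∀ x, extGen u (σ₁ • a₀ - σ₀ • a₁) 0 (σ₁ • A₀ - σ₀ • A₁) (-(σ₀ * τ₁)) t x = 0 := by
  intro t ht x
  have k₀ := h₀ t ht x
  have k₁ := h₁ t ht x
  simp only [extGen, map_add, map_smul, sub_apply, smul_apply, map_sub] at k₀ k₁ ⊢
  linear_combination (norm := module) σ₁ • k₀ - σ₀ • k₁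

/-- Skewness (`⟪Ax, x⟫ = 0`, as the crux writes it) is preserved by linear combination. -/
theorem isSkew_combine {σ₀ σ₁ : ℝ} {A₀ A₁ : E3 →L[ℝ] E3} (h₀ : ∀ x, inner ℝ (A₀ x) x = 0)
    (h₁ : ∀ x, inner ℝ (A₁ x) x = 0) : ∀ x, inner ℝ ((σ₁ • A₀ - σ₀ • A₁) x) x = 0 := by
  intro x
  simp [inner_sub_left, inner_smul_left, h₀ x, h₁ x]

/-- The zero field carries the crux's conclusion (translation by `e₀`). -/
theorem simSymmetry_of_vanishes {u : ℝ → E3 → E3} (h : ∀ t < 0, ∀ x, u t x = 0) :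
    ∃ (a : E3) (σ : ℝ) (A : E3 →L[ℝ] E3), (∀ x, inner ℝ (A x) x = 0) ∧ ¬ (a = 0 ∧ σ = 0 ∧ A = 0) ∧
      ∀ t < 0, ∀ x, fderiv ℝ (u t) x (a + σ • x + A x) + σ • u t x +
        (2 * σ * t) • timeDeriv u t x - A (u t x) = 0 := by
  refine ⟨EuclideanSpace.single 0 1, 0, 0, fun x => by simp, ?_, ?_⟩
  · rintro ⟨h0, -, -⟩
    have := congrArg (fun v : E3 => v 0) h0
    simp at this
  · intro t ht x
    have hut : u t = fun _ => 0 := funext (h t ht)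
    simp [hut]

/-! ## The five registered stubs

Each stub's statement is the `Prop` `Sig.stub_<name>` (its SIGNATURE, tree vocabulary only); the
registered obligation is `theorem stub_<name> : Sig.stub_<name> := by sorry`; `ForcedSymmetry_of` takes
the five signatures as hypotheses BY NAME. -/

/-- STUB 1 — EXTENDED FORCED SYMMETRY ("eight moduli do not fit"; HARDEST, crux-sized, XL; the crux
re-anchored). Every Type-I KNSS-mild ancient field `u ∈ A_C` is annihilated on `t < 0` by a NONZERO
element `(a, σ, A, τ)` of the extended algebra `⟨∂ₜ⟩ ⊕ sim(3)` (`A` skew): `u` is a steady state /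
travelling or rotating wave (`σ = 0 ≠ τ`), or Killing-symmetric (`σ = τ = 0`), or an exact (rotated)
scaling soliton about SOME space–time vertex `(−τ/(2σ), x_c)` — past, final or future.
Why plausibly true: it is implied by the target `X` (`A_C = {0}`), it is NECESSARY for the crux
(`extendedForcedSymmetry_of_forcedSymmetry`), and it is the rigidity form of the folklore expectation
"Type-I blow-up is asymptotically self-similar" made exact; vacuous for `C ≤ ε` (Disproof §5). Why it
might FAIL: a Type-I ancient element with DISCRETE extended stabiliser — e.g. a backward λ-DSS profile
that is not RSS (Bradshaw–Tsai 2017 OP 5.1), or any symmetry-free element — refutes it (and `X`). No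
engine is supplied by this line: any proof must use the Oseen identity H3 of `u` itself
(`forcedSymmetry_false_without_H3`, `not_forcedSymmetryOnDriftClass` apply verbatim). -/
def Sig.stub_extendedForcedSymmetry : Prop :=
  ∀ (C : ℝ) (u : ℝ → E3 → E3), IsTypeIAncientMild C u →
    ∃ (a : E3) (σ : ℝ) (A : E3 →L[ℝ] E3) (τ : ℝ), (∀ x, inner ℝ (A x) x = 0) ∧
      ¬ (a = 0 ∧ σ = 0 ∧ A = 0 ∧ τ = 0) ∧
        ∀ t < 0, ∀ x, fderiv ℝ (u t) x (a + σ • x + A x) + σ • u t x +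
          (2 * σ * t + τ) • timeDeriv u t x - A (u t x) = 0

/-- STUB 2a — FUTURE-VERTEX SOLITON LIOUVILLE, IRROTATIONAL LEAF `A = 0` (KNOWN, size M–L in Lean).
A field `u ∈ A_C` annihilated on `t < 0` by the plain scaling generator about a FUTURE vertex
`(θ, x_c)`, `θ > 0`, `x_c = −a/σ` — `∇u·(a + σx) + σu + 2σ(t − θ)∂ₜu = 0` — vanishes. Route: Euler
homogeneity along `λ ↦ λ u(θ + λ²(t − θ), x_c + λ(x − x_c))` (derivative = generator/λ = 0, joint
`C¹` from H1) gives `u(t, x) = (θ − t)^{-1/2} U((x − x_c)/√(θ − t))` on `t < 0` with ONE profile `U`,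
`‖U‖ ≤ C` (Type-I rate as `t → −∞`); `u` is classical on every window with a smooth pressure
(`IsTypeIAncientMild.exists_isClassicalNSSolutionOn_Ioo`), so after the translation `x ↦ x + x_c` and
the (forward!) time relabelling the steady profile solves Leray's system with SOME pressure profile
(`isClassicalNSSolutionOn_iff_isBackwardLeraySolutionOn_lerayOrbit`, momentum at one slice;
`IsBackwardLeraySolutionOn.momentum_leray`), i.e. `IsLerayProfile 1 (1/2) U P`; Tsai 1998 Thm 1
(`tsai_selfsimilar_bounded_holds` / `IsLerayProfile.exists_eq_const_of_bounded`) makes `U` constant,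
so every slice `u t` is constant, and the gauge kills it (`IsTypeIAncientMild.eq_zero_of_slice_const`).
Drop-H3 version FALSE (parasitic soliton `c(θ−t)^{-1/2}e₀`): the gauge is used exactly at the end. -/
def Sig.stub_futureVertexLiouvilleIrrotational : Prop :=
  ∀ (C : ℝ) (u : ℝ → E3 → E3), IsTypeIAncientMild C u →
    ∀ (a : E3) (σ θ : ℝ), σ ≠ 0 → 0 < θ →
      (∀ t < 0, ∀ x, fderiv ℝ (u t) x (a + σ • x) + σ • u t x +
        (2 * σ * (t - θ)) • timeDeriv u t x = 0) →
      ∀ t < 0, ∀ x, u t x = 0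

/-- STUB 2b — FUTURE-VERTEX SOLITON LIOUVILLE, ROTATED LEAF `A ≠ 0` (OPEN in print; shared core with
the sibling crux `SymmetricLiouville`, stmt-4053: `Cruxes/SymmetricLiouville/Disproof.lean`
`RotatedSelfSimilarLiouville`, equivalent modulo backward shift + Sim(3)-covariance of the gauge).
A field `u ∈ A_C` annihilated on `t < 0` by a ROTATED scaling generator about a future vertex
(`σ ≠ 0`, `A ≠ 0` skew, `θ > 0`) — `∇u·(a + σx + Ax) + σu + 2σ(t − θ)∂ₜu − Au = 0` — vanishes. Such a
`u` is backward rotated-self-similar about `(θ, x_c)` with rotation rate `~ ‖A‖/|σ|` and BOUNDED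
profile (`‖U‖ ≤ C`). Pineau–Vicol arXiv:2607.09619 Thm 1.4 (tree named fact
`pineauVicol2026_rss_liouville`) needs the space–time bound (1.10) (profile decaying like `1/|y|`)
and `|α| ≪ 1` or `≫ 1`; their Conj. 1.1 = Tsai 2018 Conj. 8.9 is the rest. Why it might FAIL: a
nonzero backward RSS solution with bounded profile at `α ~ 1` (no candidate in print; it would refute
4052, 4053, `X` and the route at once). -/
def Sig.stub_futureVertexLiouvilleRotated : Prop :=
  ∀ (C : ℝ) (u : ℝ → E3 → E3), IsTypeIAncientMild C u →
    ∀ (a : E3) (σ : ℝ) (A : E3 →L[ℝ] E3) (θ : ℝ), (∀ x, inner ℝ (A x) x = 0) → A ≠ 0 → σ ≠ 0 →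
      0 < θ →
      (∀ t < 0, ∀ x, fderiv ℝ (u t) x (a + σ • x + A x) + σ • u t x +
        (2 * σ * (t - θ)) • timeDeriv u t x - A (u t x) = 0) →
      ∀ t < 0, ∀ x, u t x = 0

/-- STUB 3 — INTERIOR-VERTEX VANISHING (the VERTEX LEMMA of card backward-shift-self-improvement;
elementary, size M in Lean). If `u ∈ A_C` is annihilated on a backward end `t < T` (`T ≤ 0`) by a
(rotated) scaling generator (`σ ≠ 0`) whose time vertex `θ` lies in the OPEN slab, `θ < 0`, and in the
closed end, `θ ≤ T`, then `u ≡ 0` on `t < T`. Proof: `x_c := −(σ + A)⁻¹a` exists (`⟪(σ+A)x,x⟫ = σ‖x‖²`);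
along the characteristic `t(r) − θ = e^{2r}(t₀ − θ)`, `x(r) − x_c = e^{r}e^{(r/σ)A}(x₀ − x_c)` of the
space–time field `σ⁻¹(2σ(t−θ), a + σx + Ax)` the identity reads `v' = (σ⁻¹A − 1)v` for
`v(r) = u(t(r),x(r))`, so `‖v(r)‖ = e^{−r}‖u(t₀,x₀)‖` (`A` skew); as `r → −∞` the characteristic runs
INTO the vertex `(θ, x_c)`, an interior point of the slab where `u` is continuous (H1), while
`‖v‖ → ∞` unless `u(t₀,x₀) = 0`. Uses only joint `C¹`-smoothness of `u` on the slab (no H3, no H4). -/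
def Sig.stub_interiorVertexVanishing : Prop :=
  ∀ (C : ℝ) (u : ℝ → E3 → E3), IsTypeIAncientMild C u →
    ∀ (a : E3) (σ : ℝ) (A : E3 →L[ℝ] E3) (θ T : ℝ), (∀ x, inner ℝ (A x) x = 0) → σ ≠ 0 →
      θ < 0 → θ ≤ T → T ≤ 0 →
      (∀ t < T, ∀ x, fderiv ℝ (u t) x (a + σ • x + A x) + σ • u t x +
        (2 * σ * (t - θ)) • timeDeriv u t x - A (u t x) = 0) →
      ∀ t < T, ∀ x, u t x = 0

/-- STUB 4 — RIGID CO-MOTION VANISHES (elementary, size M in Lean). If `u ∈ A_C` is annihilated on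
`t < 0` by `τ∂ₜ + (a + Ax)·∇ − A` with `τ ≠ 0` and `A` skew, then `u ≡ 0` on `t < 0`. Proof: along the
characteristic `r ↦ (t₀ + τr, Φ_r x₀)`, `Φ` the flow of the complete affine field `x ↦ a + Ax`
(`Φ_r x₀ = x₀ + ∫₀ʳ e^{ρA}(a + Ax₀)dρ`), `v(r) = u(t₀ + τr, Φ_r x₀)` satisfies `v' = Av`, so
`d/dr ‖v‖² = 2⟪Av,v⟫ = 0` and `‖v(r)‖ = ‖u(t₀,x₀)‖`; sending `τr → −∞` inside the slab,
`‖u(t₀,x₀)‖ ≤ C/√(−t₀ − τr) → 0` (H4). Uses H1 + H4 only (constants ARE rigid co-movers and are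
excluded exactly by H4). -/
def Sig.stub_rigidComotionVanishing : Prop :=
  ∀ (C : ℝ) (u : ℝ → E3 → E3), IsTypeIAncientMild C u →
    ∀ (a : E3) (A : E3 →L[ℝ] E3) (τ : ℝ), (∀ x, inner ℝ (A x) x = 0) → τ ≠ 0 →
      (∀ t < 0, ∀ x, fderiv ℝ (u t) x (a + A x) + τ • timeDeriv u t x - A (u t x) = 0) →
      ∀ t < 0, ∀ x, u t x = 0

/-! ### Registered obligations

The five `theorem stub_<name>` below carry their signatures EXPLICITLY and in fully qualified tree
vocabulary (no `open`, no local abbreviation), byte-for-byte the text a `Theorems/` file must restate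
to land the stub `--supports stmt-NavierStokesRegularity-4052` (the gate matches name + signature);
each is definitionally `Sig.stub_<name>` above. -/

/-- Registered stub 1 (extended forced symmetry — hardest; held by the lead). Signature =
`Sig.stub_extendedForcedSymmetry` written out. -/
theorem stub_extendedForcedSymmetry :
    ∀ (C : ℝ) (u : ℝ → EuclideanSpace ℝ (Fin 3) → EuclideanSpace ℝ (Fin 3)),
      Literature.Analysis.FluidPDE.IsTypeIAncientMild C u →
      ∃ (a : EuclideanSpace ℝ (Fin 3)) (σ : ℝ) (A : EuclideanSpace ℝ (Fin 3) →L[ℝ] EuclideanSpace ℝ (Fin 3)) (τ : ℝ),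
        (∀ x, inner ℝ (A x) x = 0) ∧ ¬ (a = 0 ∧ σ = 0 ∧ A = 0 ∧ τ = 0) ∧
        ∀ t < 0, ∀ x, fderiv ℝ (u t) x (a + σ • x + A x) + σ • u t x +
          (2 * σ * t + τ) • Literature.Analysis.FluidPDE.timeDeriv u t x - A (u t x) = 0 := by
  sorry

/-- Registered stub 2a (future-vertex soliton Liouville, irrotational leaf — Tsai). Signature =
`Sig.stub_futureVertexLiouvilleIrrotational` written out. -/
theorem stub_futureVertexLiouvilleIrrotational :
    ∀ (C : ℝ) (u : ℝ → EuclideanSpace ℝ (Fin 3) → EuclideanSpace ℝ (Fin 3)),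
      Literature.Analysis.FluidPDE.IsTypeIAncientMild C u →
      ∀ (a : EuclideanSpace ℝ (Fin 3)) (σ θ : ℝ), σ ≠ 0 → 0 < θ →
        (∀ t < 0, ∀ x, fderiv ℝ (u t) x (a + σ • x) + σ • u t x +
          (2 * σ * (t - θ)) • Literature.Analysis.FluidPDE.timeDeriv u t x = 0) →
        ∀ t < 0, ∀ x, u t x = 0 := by
  sorry

/-- Registered stub 2b (future-vertex soliton Liouville, rotated leaf — open RSS core of 4053).
Signature = `Sig.stub_futureVertexLiouvilleRotated` written out. -/
theorem stub_futureVertexLiouvilleRotated :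
    ∀ (C : ℝ) (u : ℝ → EuclideanSpace ℝ (Fin 3) → EuclideanSpace ℝ (Fin 3)),
      Literature.Analysis.FluidPDE.IsTypeIAncientMild C u →
      ∀ (a : EuclideanSpace ℝ (Fin 3)) (σ : ℝ) (A : EuclideanSpace ℝ (Fin 3) →L[ℝ] EuclideanSpace ℝ (Fin 3)) (θ : ℝ),
        (∀ x, inner ℝ (A x) x = 0) → A ≠ 0 → σ ≠ 0 → 0 < θ →
        (∀ t < 0, ∀ x, fderiv ℝ (u t) x (a + σ • x + A x) + σ • u t x +
          (2 * σ * (t - θ)) • Literature.Analysis.FluidPDE.timeDeriv u t x - A (u t x) = 0) →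
        ∀ t < 0, ∀ x, u t x = 0 := by
  sorry

/-- Registered stub 3 (interior-vertex vanishing — the vertex lemma). Signature =
`Sig.stub_interiorVertexVanishing` written out. -/
theorem stub_interiorVertexVanishing :
    ∀ (C : ℝ) (u : ℝ → EuclideanSpace ℝ (Fin 3) → EuclideanSpace ℝ (Fin 3)),
      Literature.Analysis.FluidPDE.IsTypeIAncientMild C u →
      ∀ (a : EuclideanSpace ℝ (Fin 3)) (σ : ℝ) (A : EuclideanSpace ℝ (Fin 3) →L[ℝ] EuclideanSpace ℝ (Fin 3)) (θ T : ℝ),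
        (∀ x, inner ℝ (A x) x = 0) → σ ≠ 0 → θ < 0 → θ ≤ T → T ≤ 0 →
        (∀ t < T, ∀ x, fderiv ℝ (u t) x (a + σ • x + A x) + σ • u t x +
          (2 * σ * (t - θ)) • Literature.Analysis.FluidPDE.timeDeriv u t x - A (u t x) = 0) →
        ∀ t < T, ∀ x, u t x = 0 := by
  sorry

/-- Registered stub 4 (rigid co-motion vanishes). Signature = `Sig.stub_rigidComotionVanishing`
written out. -/
theorem stub_rigidComotionVanishing :
    ∀ (C : ℝ) (u : ℝ → EuclideanSpace ℝ (Fin 3) → EuclideanSpace ℝ (Fin 3)),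
      Literature.Analysis.FluidPDE.IsTypeIAncientMild C u →
      ∀ (a : EuclideanSpace ℝ (Fin 3)) (A : EuclideanSpace ℝ (Fin 3) →L[ℝ] EuclideanSpace ℝ (Fin 3)) (τ : ℝ),
        (∀ x, inner ℝ (A x) x = 0) → τ ≠ 0 →
        (∀ t < 0, ∀ x, fderiv ℝ (u t) x (a + A x) + τ • Literature.Analysis.FluidPDE.timeDeriv u t x
          - A (u t x) = 0) →
        ∀ t < 0, ∀ x, u t x = 0 := by
  sorry

/-- The registered obligations ARE the signatures (definitional check, both directions trivial). -/
theorem stubs_are_sigs :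
    (Sig.stub_extendedForcedSymmetry ↔ (∀ (C : ℝ) (u : ℝ → E3 → E3), IsTypeIAncientMild C u →
      ∃ (a : E3) (σ : ℝ) (A : E3 →L[ℝ] E3) (τ : ℝ), (∀ x, inner ℝ (A x) x = 0) ∧
        ¬ (a = 0 ∧ σ = 0 ∧ A = 0 ∧ τ = 0) ∧ ∀ t < 0, ∀ x, extGen u a σ A τ t x = 0)) ∧
    (Sig.stub_rigidComotionVanishing ↔ (∀ (C : ℝ) (u : ℝ → E3 → E3), IsTypeIAncientMild C u →
      ∀ (a : E3) (A : E3 →L[ℝ] E3) (τ : ℝ), (∀ x, inner ℝ (A x) x = 0) → τ ≠ 0 →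
        (∀ t < 0, ∀ x, extGen u a 0 A τ t x = 0) → ∀ t < 0, ∀ x, u t x = 0)) := by
  refine ⟨Iff.rfl, ?_⟩
  simp only [Sig.stub_rigidComotionVanishing, extGen_sigma_zero]

/-! ## The composition: the five stubs give the crux BY NAME -/

/-- The two leaves give future-vertex soliton Liouville for every skew `A` (case split on `A = 0`). -/
def FutureVertexLiouville : Prop :=
  ∀ (C : ℝ) (u : ℝ → E3 → E3), IsTypeIAncientMild C u →
    ∀ (a : E3) (σ : ℝ) (A : E3 →L[ℝ] E3) (θ : ℝ), (∀ x, inner ℝ (A x) x = 0) → σ ≠ 0 → 0 < θ →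
      (∀ t < 0, ∀ x, extGen u a σ A (-2 * σ * θ) t x = 0) → ∀ t < 0, ∀ x, u t x = 0

/-- `stub 2a ∧ stub 2b ⇒ FutureVertexLiouville` (case split on `A = 0`; pure logic). -/
theorem futureVertexLiouville_of_leaves (hI : Sig.stub_futureVertexLiouvilleIrrotational)
    (hR : Sig.stub_futureVertexLiouvilleRotated) : FutureVertexLiouville := by
  intro C u hu a σ A θ hA hσ hθ hgen
  by_cases hA0 : A = 0
  · subst hA0
    refine hI C u hu a σ θ hσ hθ fun t ht x => ?_
    rw [← extGen_vertex_irrot]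
    exact hgen t ht x
  · refine hR C u hu a σ A θ hA hA0 hσ hθ fun t ht x => ?_
    rw [← extGen_vertex]
    exact hgen t ht x

/-- **The line.** `ExtendedForcedSymmetry → FutureVertexLiouville{Irrotational, Rotated} →
InteriorVertexVanishing → RigidComotionVanishing → ForcedSymmetry`. Pure logic: take the extended
generator `(a, σ, A, τ)` of `u ∈ A_C` (stub 1). If `τ = 0` it IS a crux witness. If `τ ≠ 0 = σ`, stub 4
kills `u`; if `τ ≠ 0 ≠ σ` the vertex `θ = −τ/(2σ) ≠ 0` is interior (`θ < 0`: stub 3 with `T = 0`) or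
future (`θ > 0`: stubs 2a/2b), and `u ≡ 0`; the zero field is translation-invariant. -/
theorem ForcedSymmetry_of :
    Sig.stub_extendedForcedSymmetry → Sig.stub_futureVertexLiouvilleIrrotational →
      Sig.stub_futureVertexLiouvilleRotated → Sig.stub_interiorVertexVanishing →
        Sig.stub_rigidComotionVanishing → ForcedSymmetry := by
  intro hE hI hRot hV hR C u hu
  have hu' : IsTypeIAncientMild C u := isTypeIAncientMild_iff.2 hu
  obtain ⟨a, σ, A, τ, hA, hne, hgen⟩ := hE C u hu'
  have hgen' : ∀ t < 0, ∀ x, extGen u a σ A τ t x = 0 := hgen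
  by_cases hτ : τ = 0
  · subst hτ
    refine ⟨a, σ, A, hA, fun h => hne ⟨h.1, h.2.1, h.2.2, rfl⟩, fun t ht x => ?_⟩
    rw [← extGen_tau_zero]
    exact hgen' t ht x
  by_cases hσ : σ = 0
  · subst hσ
    refine simSymmetry_of_vanishes (hR C u hu' a A τ hA hτ fun t ht x => ?_)
    rw [← extGen_sigma_zero]
    exact hgen' t ht x
  -- `σ ≠ 0 ≠ τ`: the vertex `θ = -τ/(2σ)` is interior or future
  obtain ⟨θ, rfl⟩ : ∃ θ : ℝ, τ = -2 * σ * θ := ⟨-τ / (2 * σ), by field_simp⟩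
  have hθ0 : θ ≠ 0 := by
    rintro rfl
    exact hτ (by ring)
  rcases lt_or_gt_of_ne hθ0 with hθ | hθ
  · refine simSymmetry_of_vanishes fun t ht x => ?_
    refine hV C u hu' a σ A θ 0 hA hσ hθ hθ.le le_rfl (fun s hs y => ?_) t ht x
    rw [← extGen_vertex]
    exact hgen' s hs y
  · exact simSymmetry_of_vanishes (futureVertexLiouville_of_leaves hI hRot C u hu' a σ A θ hA hσ hθ hgen')

/-- The skeleton instantiated on the registered stubs: it becomes the crux proof when the last
`stub_*` is discharged (until then it depends on `sorryAx` through the stubs only). -/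
theorem ForcedSymmetry_proof : ForcedSymmetry :=
  ForcedSymmetry_of stub_extendedForcedSymmetry stub_futureVertexLiouvilleIrrotational
    stub_futureVertexLiouvilleRotated stub_interiorVertexVanishing stub_rigidComotionVanishing

/-! ## Tightness: the two hard stubs are necessary for the crux (sorry-free) -/

/-- The crux implies stub 1 (take `τ = 0`). -/
theorem extendedForcedSymmetry_of_forcedSymmetry : ForcedSymmetry → Sig.stub_extendedForcedSymmetry := by
  intro hFS C u hu
  obtain ⟨a, σ, A, hA, hne, h⟩ := hFS C u (isTypeIAncientMild_iff.1 hu)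
  refine ⟨a, σ, A, 0, hA, fun hh => hne ⟨hh.1, hh.2.1, hh.2.2.1⟩, fun t ht x => ?_⟩
  rw [add_zero]
  exact h t ht x

/-- The Killing leaf of the sibling crux `SymmetricLiouville` (`σ = 0`: translation, rotation, screw),
on `t < 0`: used here only as a hypothesis of the tightness theorem below. NOT a stub of this line. -/
def KillingLiouville : Prop :=
  ∀ (C : ℝ) (u : ℝ → E3 → E3), IsTypeIAncientMild C u →
    ∀ (a : E3) (A : E3 →L[ℝ] E3), (∀ x, inner ℝ (A x) x = 0) → ¬ (a = 0 ∧ A = 0) →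
      (∀ t < 0, ∀ x, extGen u a 0 A 0 t x = 0) → ∀ t < 0, ∀ x, u t x = 0

/-- **THE TIME-ANCHOR BOOTSTRAP, as tightness of stubs 2a/2b.** Given the elementary stub 4 and the
Killing leaf, the CRUX implies future-vertex soliton Liouville: if `u ∈ A_C` is a soliton about a future
vertex `(θ, x_c)`, `θ > 0` (generator `ξ₁ = (a₁, σ₁, A₁, −2σ₁θ)`), and the crux hands a `t = 0`-anchored
`ξ₀ = (a₀, σ₀, A₀, 0)`, then either `σ₀ = 0` (Killing leaf) or `σ₁ξ₀ − σ₀ξ₁` is a rigid co-motion with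
`τ = 2σ₀σ₁θ ≠ 0` (stub 4): `u ≡ 0`. Hence any refutation of stub 2b (a nonzero bounded-profile backward
RSS solution, shifted to blow up in the future) refutes the crux. -/
theorem futureVertexLiouville_of_forcedSymmetry :
    Sig.stub_rigidComotionVanishing → KillingLiouville → ForcedSymmetry → FutureVertexLiouville := by
  intro hR hK hFS C u hu a₁ σ₁ A₁ θ hA₁ hσ₁ hθ h₁
  obtain ⟨a₀, σ₀, A₀, hA₀, hne₀, h₀⟩ := hFS C u (isTypeIAncientMild_iff.1 hu)
  have h₀' : ∀ t < (0 : ℝ), ∀ x, extGen u a₀ σ₀ A₀ 0 t x = 0 := fun t ht x => by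
    rw [extGen_tau_zero]; exact h₀ t ht x
  by_cases hσ₀ : σ₀ = 0
  · subst hσ₀
    exact hK C u hu a₀ A₀ hA₀ (fun hh => hne₀ ⟨hh.1, rfl, hh.2⟩) h₀'
  · have hcomb := extGen_combine (T := 0) h₀' h₁
    have hτ : -(σ₀ * (-2 * σ₁ * θ)) ≠ 0 := by
      have : σ₀ * σ₁ * θ ≠ 0 := mul_ne_zero (mul_ne_zero hσ₀ hσ₁) hθ.ne'
      intro hh; apply this; linarith
    refine hR C u hu (σ₁ • a₀ - σ₀ • a₁) (σ₁ • A₀ - σ₀ • A₁) (-(σ₀ * (-2 * σ₁ * θ)))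
      (isSkew_combine hA₀ hA₁) hτ fun t ht x => ?_
    rw [← extGen_sigma_zero]
    exact hcomb t ht x

/-- Corollary recorded for the route: with this line's stubs 2a, 2b, 3, 4 and the Killing leaf in hand,
the crux is EQUIVALENT to its re-anchored form stub 1. -/
theorem forcedSymmetry_iff_extended (hI : Sig.stub_futureVertexLiouvilleIrrotational)
    (hRot : Sig.stub_futureVertexLiouvilleRotated) (hV : Sig.stub_interiorVertexVanishing)
    (hR : Sig.stub_rigidComotionVanishing) :
    ForcedSymmetry ↔ Sig.stub_extendedForcedSymmetry :=
  ⟨extendedForcedSymmetry_of_forcedSymmetry, fun hE => ForcedSymmetry_of hE hI hRot hV hR⟩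

end Summit.NavierStokesRegularity.NavierStokesRegularity.Cruxes.ForcedSymmetry.TimeAnchorBootstrap

end
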